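import Summits.ResolutionOfSingularities.ResolutionOfSingularities.Theorems.FrobeniusClosingSteerLowTowerTorsor
import Summits.ResolutionOfSingularities.ResolutionOfSingularities.Theorems.FrobeniusClosingSteerIntegralNotQuadratic
import Literature.AlgebraicGeometry.Resolution.AffineDomainDimension
import Mathlib.RingTheory.IntegralClosure.IsIntegralClosure.Basic
import HarnessLib

/-!
# D3a part 8 (frame): one CURVE stage of the LOW tower — properness, Noetherianity, integrality, not a quadratic transform
(res-D-pv-012 AS res-L0-w41-stub-8; W4.1 crux `Steer`, LOW branch, strat-2 §σ2.24 `IsLowTowerTwo` clauses (T2)/(T7).) OURS; AI.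

For a local subring `A ⊆ L`, `T² = h ∈ A` with `h` not a square of a fraction of `A`, and the curve step `T' = (T − g)/x` (`g ∈ A`,
`x ∈ 𝔪_A ∖ 0`, `T'² = h' ∈ A`):
* `isNoetherianRing_closure_insert` — `A[T]` is Noetherian when `A` is;
* `closure_insert_ne_curveStep` — `A[T] ≠ A[T']` (properness of the partial normalisation);
* `isIntegral_of_mem_closure_insert`, `algebra_isIntegral_of_forall`, `ringKrullDim_closure_insert_eq` — `A[T']` is integral over
  `A[T]` (instance form, for res-type-096's (T7c)), `dim A[T] = dim A`;
* `not_isQuadraticTransform_curveStep` — (T7c) `A[T] ⊂ A[T']` is not a quadratic transform, for `A` Noetherian of dimension `≥ 2`;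
* `isFractionRing_of_gen` — `Frac (A[T]) = L` when `L = Frac(A) ⊕ Frac(A)·T`.
-/

noncomputable section
set_option linter.dupNamespace false

namespace Summit.ResolutionOfSingularities.ResolutionOfSingularities.Theorems.SwitchingDichotomy.LowTower

open IsLocalRing Polynomial
open Literature.AlgebraicGeometry.Resolution

variable {L : Type} [Field L]

/-- `A[T]` (`T² = h ∈ A`) is Noetherian when `A` is: it is the image of `A[X]/(X² − h)`. [folklore] -/
theorem isNoetherianRing_closure_insert (A : Subring L) [IsNoetherianRing A] {T h : L} (hh : h ∈ A) (hT : T ^ 2 = h) :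
    IsNoetherianRing (Subring.closure (insert T (A : Set L))) := by
  rw [closure_insert_eq_lift_range A hh hT]
  exact isNoetherianRing_range _

/-- **Properness of the curve step**: `A[T] ≠ A[T']` for `T' = (T − g)/x` with `x ∈ 𝔪_A` (if `T' = a + bT` then `(1 − xb)T = xa + g`,
so either `x` is a unit of `A` or `T` is a fraction of `A`, contradicting the hygiene `h ≠ (u/v)²`). [folklore] -/
theorem closure_insert_ne_curveStep (A : Subring L) [IsLocalRing A] {T h g x : L} (hh : h ∈ A) (hT : T ^ 2 = h)
    (hnr : ∀ u v : A, (v : L) ≠ 0 → ((u : L) / (v : L)) ^ 2 ≠ h)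
    (hg : g ∈ A) (hxA : x ∈ A) (hxm : (⟨x, hxA⟩ : A) ∈ maximalIdeal A) (hx0 : x ≠ 0) :
    Subring.closure (insert T (A : Set L)) ≠ Subring.closure (insert ((T - g) / x) (A : Set L)) := by
  intro heq
  have hT' : (T - g) / x ∈ Subring.closure (insert T (A : Set L)) := by
    rw [heq]; exact Subring.subset_closure (Set.mem_insert _ _)
  obtain ⟨a, ha, b, hb, hab⟩ := (mem_closure_insert_iff A hh hT _).mp hT'
  -- `(1 - x b) T = x a + g`
  have hlin : (1 - x * b) * T = x * a + g := by
    have : T - g = x * (a + b * T) := by rw [← hab, mul_div_cancel₀ _ hx0]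
    linear_combination this
  by_cases hxb : 1 - x * b = 0
  · -- then `x` is a unit of `A`
    have hunit : IsUnit (⟨x, hxA⟩ : A) :=
      IsUnit.of_mul_eq_one (b := ⟨b, hb⟩) (Subtype.ext (by simpa using (sub_eq_zero.mp hxb).symm))
    exact hxm hunit
  · -- else `T` is a fraction of `A`
    have hTeq : (x * a + g) / (1 - x * b) = T := by
      rw [div_eq_iff hxb]
      linear_combination (-1 : L) * hlin
    have hu : x * a + g ∈ A := A.add_mem (A.mul_mem hxA ha) hg
    have hv : 1 - x * b ∈ A := A.sub_mem A.one_mem (A.mul_mem hxA hb)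
    have key := hnr ⟨x * a + g, hu⟩ ⟨1 - x * b, hv⟩ hxb
    apply key
    show ((x * a + g) / (1 - x * b)) ^ 2 = h
    rw [hTeq, hT]

/-- Every element of `A[T']` (`T'² = h' ∈ A`) is integral over any subring `Y ⊇ A`. [folklore] -/
theorem isIntegral_of_mem_closure_insert (A Y : Subring L) (hAY : A ≤ Y) {T' h' : L} (hh' : h' ∈ A) (hT' : T' ^ 2 = h')
    {z : L} (hz : z ∈ Subring.closure (insert T' (A : Set L))) : IsIntegral Y z := by
  induction hz using Subring.closure_induction with
  | mem w hw =>
    rcases hw with rfl | hw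
    · refine ⟨X ^ 2 - C ⟨h', hAY hh'⟩, monic_X_pow_sub_C _ two_ne_zero, ?_⟩
      simp only [eval₂_sub, eval₂_X_pow, eval₂_C, hT']
      exact sub_self h'
    · exact isIntegral_algebraMap (R := Y) (A := L) (x := ⟨w, hAY hw⟩)
  | zero => exact isIntegral_zero
  | one => exact isIntegral_one
  | add _ _ _ _ ha hb => exact ha.add hb
  | neg _ _ ha => exact ha.neg
  | mul _ _ _ _ ha hb => exact ha.mul hb

/-- Integrality in instance form: if every element of `Y'` is integral over `Y ≤ Y'` inside `L`, then `Y'` is an integral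
`Y`-algebra along the inclusion. [folklore] -/
theorem algebra_isIntegral_of_forall (Y Y' : Subring L) (hle : Y ≤ Y') (hint : ∀ z ∈ Y', IsIntegral Y z) :
    letI := (Subring.inclusion hle).toAlgebra
    Algebra.IsIntegral Y Y' := by
  letI alg : Algebra Y Y' := (Subring.inclusion hle).toAlgebra
  haveI : IsScalarTower Y Y' L := IsScalarTower.of_algebraMap_eq (fun _ => rfl)
  refine ⟨fun z => ?_⟩
  have h := hint (z : L) z.2
  exact (isIntegral_algHom_iff (IsScalarTower.toAlgHom Y Y' L) (fun a b hab => Subtype.ext hab)).mp h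

/-- The Krull dimension of `Y = A[T]` (`T² = h ∈ A`) is that of `A` (an injective integral extension). [cite: Matsumura1987, Thm. 9.4] -/
theorem ringKrullDim_closure_insert_eq (A Y : Subring L) {T h : L} (hh : h ∈ A) (hT : T ^ 2 = h)
    (hY : Y = Subring.closure (insert T (A : Set L))) : ringKrullDim Y = ringKrullDim A := by
  have hAY : A ≤ Y := fun z hz => hY ▸ Subring.subset_closure (Set.mem_insert_of_mem _ hz)
  letI algA : Algebra A Y := (Subring.inclusion hAY).toAlgebra
  haveI : IsScalarTower A Y L := IsScalarTower.of_algebraMap_eq (fun _ => rfl)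
  haveI : Algebra.IsIntegral A Y := by
    refine ⟨fun z => ?_⟩
    have hz : IsIntegral A (z : L) := isIntegral_of_mem_closure_insert A A le_rfl hh hT (hY ▸ z.2)
    exact (isIntegral_algHom_iff (IsScalarTower.toAlgHom A Y L) (fun a b hab => Subtype.ext hab)).mp hz
  exact ringKrullDim_eq_of_isIntegral (R := A) (S := Y) (fun a b hab => by
    have h := congrArg Subtype.val hab
    exact Subtype.ext h)

/-- **(T7c) at a curve stage**: for `A` a Noetherian local subring of dimension `≥ 2`, `Y = A[T] ≤ Y' = A[T']` (`T² = h`, `T'² = h'`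
in `A`) is NOT a quadratic transform (res-type-096's `IntegralNotQuadratic.not_isQuadraticTransform_of_isIntegral`). The subrings
`Y, Y'` are kept abstract with defining equations (kernel hygiene). [cite: Matsumura1987, Thm. 9.4 and Thm. 13.5] -/
theorem not_isQuadraticTransform_curveStep (A Y Y' : Subring L) [IsNoetherianRing A] (hdim : (2 : WithBot ℕ∞) ≤ ringKrullDim A)
    {T h T' h' : L} (hh : h ∈ A) (hT : T ^ 2 = h) (hh' : h' ∈ A) (hT' : T' ^ 2 = h')
    (hY : Y = Subring.closure (insert T (A : Set L))) (hY' : Y' = Subring.closure (insert T' (A : Set L)))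
    [IsLocalRing Y] (hle : Y ≤ Y') : ¬ IsQuadraticTransform Y Y' := by
  haveI : IsNoetherianRing Y := hY ▸ isNoetherianRing_closure_insert A hh hT
  haveI : IsNoetherianRing Y' := hY' ▸ isNoetherianRing_closure_insert A hh' hT'
  have hAY : A ≤ Y := fun z hz => hY ▸ Subring.subset_closure (Set.mem_insert_of_mem _ hz)
  have hdimY : (2 : WithBot ℕ∞) ≤ ringKrullDim Y := by
    rw [ringKrullDim_closure_insert_eq A Y hh hT hY]; exact hdim
  exact IntegralNotQuadratic.not_isQuadraticTransform_of_isIntegral hle hdimY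
    (algebra_isIntegral_of_forall Y Y' hle (fun z hz => isIntegral_of_mem_closure_insert A Y hAY hh' hT' (hY' ▸ hz)))

/-- **`Frac (A[T]) = L`** when every element of `L` is `(a + b·T)/u` with `a, b, u ∈ A`, `u ≠ 0` (i.e. `L = κ ⊕ κT`, `κ = Frac A`).
[folklore] -/
theorem isFractionRing_of_gen {k : Type} [Field k] [Algebra k L] (Y : Subalgebra k L) (A : Subring L) (hAY : A ≤ Y.toSubring)
    {T : L} (hT : T ∈ Y) (hgen : ∀ z : L, ∃ a b u : L, a ∈ A ∧ b ∈ A ∧ u ∈ A ∧ u ≠ 0 ∧ z = (a + b * T) / u) :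
    IsFractionRing Y L := by
  refine IsFractionRing.of_field Y L (fun z => ?_)
  obtain ⟨a, b, u, ha, hb, hu, hu0, rfl⟩ := hgen z
  exact ⟨⟨a + b * T, Y.add_mem (hAY ha) (Y.mul_mem (hAY hb) hT)⟩, ⟨u, hAY hu⟩, rfl⟩

end Summit.ResolutionOfSingularities.ResolutionOfSingularities.Theorems.SwitchingDichotomy.LowTower

end
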